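import Literature.AlgebraicGeometry.Resolution.BlowupSequencesPrune
import HarnessLib

/-!
# [OURS · L1 W4.2] D8-S1 infrastructure, file 4: PRUNE ALGEBRA for the replayed lower-dimensional sequences — pruning commutes
# with pulling back along an isomorphism; the head cases of `(t.comap j).prune` (crux chain w42, v7 stub `stub_isoOpenRestartLocal` ⟸
# `LocalRunSimulationM p`; hand res-D-pv-060)

OURS plumbing (cell `res-hironaka`, slot W4.2, crux `stmt-ResolutionOfSingularities-18506` / conjunct `-19249`; `--supports … --as helper`,
counted 0) over the tree's `CentreSeq.comap` / `CentreSeq.prune` / `CentreSeq.IsExtensionOf` (Kollár 3.34.1, BGMW Def. 3.1.5); NOT statements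
of the manuscript under review [claim: Hironaka2017, status: under-review] nor of [CossartJannsenSaito2020]. AI plumbing, weaker than expert review.

In the simulation (D8-S1 DESIGN §5, state (c)/(d)) the sequence still to be replayed on the pointed open is `(P.rest.comap jP).prune`
(`OracleLocal`: the oracle names `(t.restrict j).prune` on the open piece; `CentreSeq.restrict_eq_comap`). One global replay step with
centre `D` (`P.rest = cons D t₁`) updates it as follows: if the restricted centre `jP^* D` is EMPTY the step is invisible on the open and
the pending sequence is transported along the isomorphism `Bl_⊤ ≅ ·` (`prune_comap_cons_of_eq_top`, using `prune_comap_of_isIso`: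
pruning commutes with pull-back along an isomorphism — an isomorphism is flat and surjective, so it creates no empty centre, Kollár
3.30.1); otherwise the open replays `jP^* D` and continues with the pruned pull-back of the tail (`prune_comap_cons_of_ne_top`). [folklore]
-/

noncomputable section

set_option linter.dupNamespace false -- mandated namespace of this single-conjunct summit

open CategoryTheory CategoryTheory.Limits AlgebraicGeometry TopologicalSpace

universe u

namespace Summit.ResolutionOfSingularities.ResolutionOfSingularities.Cruxes.SigmaMaxModifications.IdeasL1Idea2R4

open Literature.AlgebraicGeometry.Resolution

/-- **Pruning commutes with pulling back along an isomorphism** (`e` flat and surjective creates no empty blow-up, Kollár 3.30.1;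
uniqueness of the pruned sequence among the sequences extended by `s`, Kollár 3.34.1). [cite: Kollar2007, 3.34.1 (p. 131)] -/
theorem prune_comap_of_isIso {X Y : Scheme.{u}} (s : CentreSeq X) (e : Y ⟶ X) [IsIso e] :
    (s.comap e).prune = s.prune.comap e :=
  ((CentreSeq.isExtensionOf_prune s).comap e).prune_eq ((CentreSeq.noEmptyCentres_prune s).comap e)

/-- **Head case, non-empty restricted centre**: the open replays `jP^* D` and keeps the pruned pull-back of the tail.
[cite: Kollar2007, 3.34.1 (p. 131)] -/
theorem prune_comap_cons_of_ne_top {S S' : Scheme.{u}} (D : S.IdealSheafData) (t₁ : CentreSeq (blowup D)) (jP : S' ⟶ S)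
    (hD : D.comap jP ≠ ⊤) :
    ((CentreSeq.cons D t₁).comap jP).prune = CentreSeq.cons (D.comap jP) (t₁.comap (blowup.comapMap D jP)).prune := by
  rw [CentreSeq.comap_cons, CentreSeq.prune_cons_of_ne_top hD]

/-- **Head case, empty restricted centre**: the step is invisible on the open; the pending sequence is the pruned pull-back of the
tail along `π_{jP^*D}⁻¹ ≫ Bl(jP) : S' ⟶ Bl_D(S)`. [cite: Kollar2007, 3.34.1 (p. 131)] -/
theorem prune_comap_cons_of_eq_top {S S' : Scheme.{u}} (D : S.IdealSheafData) (t₁ : CentreSeq (blowup D)) (jP : S' ⟶ S)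
    (hD : D.comap jP = ⊤) :
    haveI := CentreSeq.isIso_blowup_π_of_eq_top hD
    ((CentreSeq.cons D t₁).comap jP).prune = (t₁.comap (inv (blowup.π (D.comap jP)) ≫ blowup.comapMap D jP)).prune := by
  haveI := CentreSeq.isIso_blowup_π_of_eq_top hD
  rw [CentreSeq.comap_cons, CentreSeq.prune_cons_of_eq_top hD, CentreSeq.comap_comp,
    prune_comap_of_isIso (t₁.comap (blowup.comapMap D jP)) (inv (blowup.π (D.comap jP)))]

end Summit.ResolutionOfSingularities.ResolutionOfSingularities.Cruxes.SigmaMaxModifications.IdeasL1Idea2R4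

end
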